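import Mathlib
import HarnessLib
import Summits.HubbardSuperconductivity.HubbardSuperconductivity.Theorems.KLProgrammeH10TwoPointLimitPerturbedCountPairsThinExists
import Summits.HubbardSuperconductivity.HubbardSuperconductivity.Theorems.KLProgrammeH10TwoPointLimitPerturbedOffsetSectorCount

/-!
# Route `KLProgramme` — K3 engine child `KLRegimeEngineV17F2` (stmt-HubbardSuperconductivity-20437), stub (b) import ι₂:
# the ANCHORED four-sector count for THIN shells on the perturbed curve — `≤ K·2ⁿ`, NO `(n+1)`

Cell gate-hubbard-kl, plan g17 (R41)(i) «E1-P2-THIN-COUNT» (seat p4; file 5, model half).  The anisotropic (thin) twin of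
`offsetSectorCount_perturbed` (BGM (2.76)/(2.80) on the moving curve): sectors of angular width `w = π/2ⁿ`, shells of THICKNESS `c_T·w²` around the
perturbed curve `{ε₀ + δ = μ}` (`δ ∈ C²` even, `2πℤ²`-periodic, `|δ|, ‖Dδ‖, ‖D²δ‖ ≤ κ`), four legs with momentum conservation modulo `2πℤ²`, the sector of
the first leg (the ANCHOR) prescribed: the number of sector triples of the other three legs is `≤ K·2ⁿ` — uniformly in `δ`, `u`, `μ ∈ [μ₁, μ₂]`, the anchor
and `G` — where the isotropic count has `K·2ⁿ·(n+1)`.  Proof: every leg lies within `c_T w²/(Dt − κ)` of the curve point at its own angle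
(`cell_perturbed` at zero angular slack), so the four curve points at the legs' angles close up to `4c_T w²/(Dt − κ)` and `abs_hfunE_le_of_sum` makes
`(angle₀, angle₁, angle₂)` a NEAR-SOLUTION at radius `C_r w²` within `w/2` of the sector centres; the last leg is eliminated on the radial graph
(`card_prod3_le`, `card_grid_in_box_le_radial`); the near-solution pairs are counted by `countPairs_thin_perturbed` (`≤ K_p/w`, no logarithm).

* **`anchoredSectorCount_thin_perturbed`**.

Everything is PROVED; no definitions.  References: BGM 2006 Lemma 3.1 / (2.76) / (2.80) / App. A2–A3 [cite: BenfattoGiulianiMastropietro2006];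
Mastropietro 2008 (14.67) p. 223 (anisotropic sectors: `γ^{(h₀−h)/2}`, no `|h|`) [cite: Mastropietro2008].
-/

noncomputable section

namespace Summit.HubbardSuperconductivity.HubbardSuperconductivity.Theorems.PerturbedFermiCurve

set_option linter.dupNamespace false -- summit = problem name (single-conjunct summit), D-0017

open Classical
open Real Set
open Literature.MathematicalPhysics.QuantumLattice Literature.MathematicalPhysics.QuantumLattice.BandSectorCounting

set_option maxHeartbeats 1600000 in
/-- **The anchored four-sector count for thin shells on the perturbed Fermi curve** (E1-P2-THIN-COUNT, model half of
`card_bgmSectorSet_klAniso_anchored_le_linear`): for every level window `[μ₁, μ₂] ⊂ (−4, 0)` and thickness constant `c_T ≥ 0` there are `κ > 0` and `K`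
such that for every `C²`, even, `2πℤ²`-periodic `δ` with `|δ|, ‖Dδ‖, ‖D²δ‖ ≤ κ`, every `μ ∈ [μ₁, μ₂]`, every root selection `u`, every `n`, every reciprocal
vector `2πG` and every anchor sector `ω₁`, the number of sector triples `(ω₂, ω₃, ω₄)` admitting momenta `k_j` in the shells `|ε₀ + δ − μ| ≤ c_T w²`
(`w = π/2ⁿ`) with polar angles in the prescribed sectors and `k₁ + k₂ + k₃ + k₄ = 2πG` is at most `K·2ⁿ`.
[cite: BenfattoGiulianiMastropietro2006, Lemma 3.1 / (2.76) / (2.80) / App. A3] -/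
theorem anchoredSectorCount_thin_perturbed :
    ∀ μ₁ μ₂ cT : ℝ, -4 < μ₁ → μ₁ ≤ μ₂ → μ₂ < 0 → 0 ≤ cT → ∃ κ : ℝ, 0 < κ ∧ ∃ K : ℝ, 0 < K ∧
      ∀ δ : (Fin 2 → ℝ) → ℝ, ContDiff ℝ 2 δ → (∀ k, δ (-k) = δ k) → (∀ (k : Fin 2 → ℝ) (m : Fin 2 → ℤ), δ (fun i => k i + 2 * π * m i) = δ k) →
        (∀ k : Fin 2 → ℝ, |δ k| ≤ κ) → (∀ k : Fin 2 → ℝ, ‖fderiv ℝ δ k‖ ≤ κ) → (∀ k : Fin 2 → ℝ, ‖fderiv ℝ (fderiv ℝ δ) k‖ ≤ κ) →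
      ∀ μ ∈ Set.Icc μ₁ μ₂, ∀ u : ℝ → ℝ, (∀ θ, IsBandFermiRadius (μ - δ (u θ • dir θ)) θ (u θ)) →
      ∀ (n : ℕ) (G : Fin 2 → ℤ) (ω₁ : Fin (sectorCount n)),
      (((Finset.univ : Finset (Fin (sectorCount n) × Fin (sectorCount n) × Fin (sectorCount n))).filter
          (fun ω : Fin (sectorCount n) × Fin (sectorCount n) × Fin (sectorCount n) =>
        ∃ k : Fin 4 → Fin 2 → ℝ, (∀ j i, |k j i| ≤ Real.pi) ∧ (∀ j, |sqDispersion (k j) + δ (k j) - μ| ≤ cT * sectorWidth n ^ 2) ∧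
          sectorIndex n (Complex.arg (⟨k 0 0, k 0 1⟩ : ℂ)) = (ω₁ : ℕ) ∧
          sectorIndex n (Complex.arg (⟨k 1 0, k 1 1⟩ : ℂ)) = (ω.1 : ℕ) ∧
          sectorIndex n (Complex.arg (⟨k 2 0, k 2 1⟩ : ℂ)) = (ω.2.1 : ℕ) ∧
          sectorIndex n (Complex.arg (⟨k 3 0, k 3 1⟩ : ℂ)) = (ω.2.2 : ℕ) ∧
          (∀ i, ∑ j, k j i = 2 * Real.pi * (G i : ℝ)))).card : ℝ) ≤ K * 2 ^ n := by
  intro μ₁ μ₂ cT hμ₁ h12 hμ₂ hcT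
  -- the level range `[a', b']` and its uniform bounds
  have ha : -4 < (μ₁ - 4) / 2 := by linarith
  have hab : (μ₁ - 4) / 2 ≤ μ₂ / 2 := by linarith
  have hb : μ₂ / 2 < 0 := by linarith
  obtain ⟨B, -⟩ : ∃ B : BandBounds ((μ₁ - 4) / 2) (μ₂ / 2), B = bandBounds ha hab hb := ⟨_, rfl⟩
  set m₀ := min (μ₁ - (μ₁ - 4) / 2) (μ₂ / 2 - μ₂) with hm₀def
  have hm₀ : 0 < m₀ := lt_min (by linarith) (by linarith)
  have hm1 : m₀ ≤ μ₁ - (μ₁ - 4) / 2 := min_le_left _ _; have hm2 : m₀ ≤ μ₂ / 2 - μ₂ := min_le_right _ _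
  have hD := B.Dcell_pos; have hDt := B.Dtmin_pos; have hum := B.umin_pos; have hs := B.smax_pos; have hπ := Real.pi_pos
  -- the near-solution radius and the thin pair count
  set Cr := 40 * cT / B.Dtmin + 1 with hCr
  have hCr0 : 0 < Cr := by rw [hCr]; positivity
  obtain ⟨κp, hκp, mG, hmG, hmGm, hκG, w₁, hw₁, Kp, hKp, hcount⟩ :=
    countPairs_thin_perturbed ((μ₁ - 4) / 2) (μ₂ / 2) ha hab hb Cr (m₀ / 2) hCr0 (by positivity)
  -- the perturbation size, the threshold on `w` and the constants
  set κ := min κp (min 1 (min (B.Dtmin / 2) (m₀ / 4))) with hκdef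
  have hκ0 : 0 < κ := lt_min hκp (lt_min one_pos (lt_min (by positivity) (by positivity)))
  have hκp' : κ ≤ κp := min_le_left _ _; have hκ1 : κ ≤ 1 := (min_le_right _ _).trans (min_le_left _ _)
  have hκD : κ ≤ B.Dtmin / 2 := (min_le_right _ _).trans ((min_le_right _ _).trans (min_le_left _ _))
  have hκm : κ ≤ m₀ / 4 := (min_le_right _ _).trans ((min_le_right _ _).trans (min_le_right _ _)); have hκDt : κ < B.Dtmin := by linarith
  obtain ⟨w₀, hw₀⟩ : ∃ w₀ : ℝ, w₀ = min 1 (min (m₀ / 4) (min w₁ (1 / (cT + 1)))) := ⟨_, rfl⟩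
  have hw₀pos : 0 < w₀ := by rw [hw₀]; exact lt_min (by norm_num) (lt_min (by positivity) (lt_min hw₁ (by positivity)))
  obtain ⟨C₀, hC₀⟩ : ∃ C₀ : ℝ, C₀ = 3 * (2 * (π * (Real.sqrt 2 * (4 * (2 * B.Dcell)) / B.umin)) + 1) := ⟨_, rfl⟩
  have hC₀pos : 0 < C₀ := by rw [hC₀]; positivity
  obtain ⟨K₁, hK₁⟩ : ∃ K₁ : ℝ, K₁ = 8 * (π / w₀) ^ 2 := ⟨_, rfl⟩
  obtain ⟨K₂, hK₂⟩ : ∃ K₂ : ℝ, K₂ = C₀ * Kp / π := ⟨_, rfl⟩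
  have hK₁pos : 0 < K₁ := (by rw [hK₁]; positivity); have hK₂pos : 0 < K₂ := (by rw [hK₂]; positivity)
  refine ⟨κ, hκ0, K₁ + K₂, by positivity, ?_⟩
  intro δ hδs heven hper hδ hκ' hκ₂ μ hμ u hu n G ω₁
  have h2ne : (2 : WithTop ℕ∞) ≠ 0 := by norm_num
  have hwpos : 0 < sectorWidth n := sectorWidth_pos n; have hNw : (sectorCount n : ℝ) * sectorWidth n = 2 * π := sectorCount_mul_sectorWidth n
  have h2n : (2 : ℝ) ^ n * sectorWidth n = π := by rw [sectorWidth]; field_simp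
  have hNeq : sectorCount n = 2 * 2 ^ n := (by unfold sectorCount; ring)
  have hNreal : (sectorCount n : ℝ) = 2 * 2 ^ n := (by rw [hNeq]; push_cast; ring)
  have hsc : ∀ i : ℕ, sectorCenter n i = sectorWidth n / 2 + i * sectorWidth n := BandSectorCounting.sectorCenter_eq n
  have hcen : ∀ φ : ℝ, ∃ m : ℤ, |φ + m * (2 * π) - sectorCenter n (sectorIndex n φ)| ≤ sectorWidth n / 2 := by
    intro φ
    obtain ⟨m, hm⟩ := exists_angleRep_eq_add φ
    refine ⟨m, ?_⟩
    rw [← hm]; exact abs_angleRep_sub_sectorCenter_le n φ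
  generalize hwdef : sectorWidth n = w at hwpos hNw h2n hsc hcen ⊢
  have hμab : μ ∈ Icc ((μ₁ - 4) / 2) (μ₂ / 2) := ⟨by linarith only [hμ.1, hμ₁], by linarith only [hμ.2, hμ₂]⟩
  have h2npos : (0 : ℝ) < 2 ^ n := by positivity
  -- square-restricted forms of the perturbation hypotheses
  have hδsq : ∀ k : Fin 2 → ℝ, (∀ i, |k i| ≤ π) → |δ k| ≤ κ := fun k _ => hδ k
  have hdsq : ∀ k : Fin 2 → ℝ, (∀ i, |k i| ≤ π) → DifferentiableAt ℝ δ k := fun k _ => (hδs.differentiable h2ne) k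
  have hκsq : ∀ k : Fin 2 → ℝ, (∀ i, |k i| ≤ π) → ‖fderiv ℝ δ k‖ ≤ κ := fun k _ => hκ' k
  have hLip : ∀ k k' : Fin 2 → ℝ, (∀ i, |k i| ≤ π) → (∀ i, |k' i| ≤ π) → |δ k - δ k'| ≤ κ * ‖k - k'‖ :=
    fun k k' hk hk' => lipschitz_of_fderiv_le hdsq hκsq hk hk'
  -- the trivial bound `N³`
  have htriv : ∀ (pr : Fin (sectorCount n) × Fin (sectorCount n) × Fin (sectorCount n) → Prop) [DecidablePred pr],
      ((((Finset.univ : Finset (Fin (sectorCount n) × Fin (sectorCount n) × Fin (sectorCount n))).filter pr).card : ℝ)) ≤ (sectorCount n : ℝ) ^ 3 := by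
    intro pr _
    have h1 := Finset.card_filter_le (Finset.univ : Finset (Fin (sectorCount n) × Fin (sectorCount n) × Fin (sectorCount n))) pr
    rw [Finset.card_univ, Fintype.card_prod, Fintype.card_prod, Fintype.card_fin] at h1
    have : ((((Finset.univ : Finset (Fin (sectorCount n) × Fin (sectorCount n) × Fin (sectorCount n))).filter pr).card : ℝ)) ≤
        ((sectorCount n * (sectorCount n * sectorCount n) : ℕ) : ℝ) := by exact_mod_cast h1
    calc _ ≤ ((sectorCount n * (sectorCount n * sectorCount n) : ℕ) : ℝ) := this
      _ = (sectorCount n : ℝ) ^ 3 := by push_cast; ring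
  by_cases hwle : w ≤ w₀
  · -- the main case
    have hw1 : w ≤ 1 := hwle.trans (by rw [hw₀]; exact min_le_left _ _)
    have hwm : w ≤ m₀ / 4 := hwle.trans (by rw [hw₀]; exact (min_le_right _ _).trans (min_le_left _ _))
    have hww₁ : w ≤ w₁ := hwle.trans (by rw [hw₀]; exact (min_le_right _ _).trans ((min_le_right _ _).trans (min_le_left _ _)))
    have hwT : w ≤ 1 / (cT + 1) := hwle.trans (by rw [hw₀]; exact (min_le_right _ _).trans ((min_le_right _ _).trans (min_le_right _ _)))
    have hTw : cT * w ^ 2 ≤ w := by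
      have h1 : cT * w ≤ 1 := by
        rw [le_div_iff₀ (by positivity)] at hwT; nlinarith [hwT, hwpos]
      nlinarith [h1, hwpos]
    have hlo : (μ₁ - 4) / 2 ≤ μ - κ - w := by linarith only [hμ.1, hm1, hκm, hwm, hm₀]
    have hhi : μ + κ + w ≤ μ₂ / 2 := by linarith only [hμ.2, hm2, hκm, hwm, hm₀]
    have hloT : (μ₁ - 4) / 2 ≤ μ - κ - cT * w ^ 2 := by linarith only [hlo, hTw]
    have hhiT : μ + κ + cT * w ^ 2 ≤ μ₂ / 2 := by linarith only [hhi, hTw]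
    have hlo' : (μ₁ - 4) / 2 ≤ μ - κ := (by linarith only [hlo, hwpos]); have hhi' : μ + κ ≤ μ₂ / 2 := (by linarith only [hhi, hwpos])
    have hloG : (μ₁ - 4) / 2 ≤ μ - κp - mG := (by linarith only [hμ.1, hm1, hm₀, hκG, hmGm])
    have hhiG : μ + κp + mG ≤ μ₂ / 2 := (by linarith only [hμ.2, hm2, hm₀, hκG, hmGm])
    -- the perturbed cell radius is at most `2 D_cell w`
    have hrad : (cT * w ^ 2 + B.smax * B.Dtmin * (w / 2)) / (B.Dtmin - κ) ≤ 2 * B.Dcell * w := by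
      rw [div_le_iff₀ (sub_pos.2 hκDt)]
      unfold BandBounds.Dcell
      have e : 2 * (1 / B.Dtmin + B.smax / 2) * w * (B.Dtmin - κ) =
          (w + B.smax * B.Dtmin * (w / 2)) + (w + B.smax * B.Dtmin * (w / 2)) * (1 - 2 * κ / B.Dtmin) := by
        field_simp; ring
      rw [e]
      have h1 : 0 ≤ 1 - 2 * κ / B.Dtmin := by
        rw [sub_nonneg, div_le_one hDt]; linarith only [hκD]
      have h2 : 0 ≤ w + B.smax * B.Dtmin * (w / 2) := by positivity
      nlinarith only [h1, h2, hTw]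
    -- the radial projection error `ρ = c_T w²/(Dt − κ)` and the near-solution radius
    have hρCr : (4 + κ) * (4 * (cT * w ^ 2 / (B.Dtmin - κ))) ≤ Cr * w ^ 2 := by
      have hden : B.Dtmin / 2 ≤ B.Dtmin - κ := by linarith only [hκD]
      have h1 : cT * w ^ 2 / (B.Dtmin - κ) ≤ cT * w ^ 2 / (B.Dtmin / 2) :=
        div_le_div_of_nonneg_left (by positivity) (by positivity) hden
      have h2 : (4 + κ) * (4 * (cT * w ^ 2 / (B.Dtmin - κ))) ≤ 5 * (4 * (cT * w ^ 2 / (B.Dtmin / 2))) :=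
        mul_le_mul (by linarith only [hκ1]) (by linarith only [h1]) (by positivity) (by norm_num)
      refine h2.trans ?_
      rw [hCr]
      have e : 5 * (4 * (cT * w ^ 2 / (B.Dtmin / 2))) = (40 * cT / B.Dtmin) * w ^ 2 := by field_simp; ring
      rw [e]; nlinarith only [sq_nonneg w]
    -- the cells: every admissible leg in sector `ω` is within `2 D_cell w` of the centre point, and within `ρ` of the point at its own angle
    have hcell : ∀ (k : Fin 2 → ℝ) (ωj : ℕ), (∀ i, |k i| ≤ π) → |sqDispersion k + δ k - μ| ≤ cT * w ^ 2 →
        sectorIndex n (Complex.arg (⟨k 0, k 1⟩ : ℂ)) = ωj → ∀ i : Fin 2, |k i - (u (w / 2 + (ωj : ℝ) * w) • dir (w / 2 + (ωj : ℝ) * w)) i| ≤ 2 * B.Dcell * w := by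
      intro k ωj hk hsh hωj i
      obtain ⟨m, hm⟩ := hcen (Complex.arg (⟨k 0, k 1⟩ : ℂ))
      rw [hωj, hsc] at hm
      exact (cell_perturbed B hδsq hLip hκDt hu hk hsh hloT hhiT hm i).trans hrad
    have hproj : ∀ (k : Fin 2 → ℝ) (ωj : ℕ), (∀ i, |k i| ≤ π) → |sqDispersion k + δ k - μ| ≤ cT * w ^ 2 →
        sectorIndex n (Complex.arg (⟨k 0, k 1⟩ : ℂ)) = ωj →
        ∃ φ : ℝ, |w / 2 + (ωj : ℝ) * w - φ| ≤ w ∧ ∀ i : Fin 2, |k i - (u φ • dir φ) i| ≤ cT * w ^ 2 / (B.Dtmin - κ) := by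
      intro k ωj hk hsh hωj
      obtain ⟨m, hm⟩ := hcen (Complex.arg (⟨k 0, k 1⟩ : ℂ))
      rw [hωj, hsc] at hm
      refine ⟨Complex.arg (⟨k 0, k 1⟩ : ℂ) + m * (2 * π), by rw [abs_sub_comm]; linarith only [hm, hwpos], fun i => ?_⟩
      have h := cell_perturbed B hδsq hLip hκDt hu hk hsh hloT hhiT (θ₀ := Complex.arg (⟨k 0, k 1⟩ : ℂ) + m * (2 * π)) (m := m) (α := 0)
        (by rw [sub_self, abs_zero]) i
      simpa using h
    -- Step 1: elimination of the last index (fibre) and near-solutions (implication)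
    set θ₁ := w / 2 + ((ω₁ : ℕ) : ℝ) * w with hθ₁
    have hmain := card_prod3_le (N := sectorCount n)
      (Q := fun i c d => ∃ k : Fin 4 → Fin 2 → ℝ, (∀ j i, |k j i| ≤ Real.pi) ∧ (∀ j, |sqDispersion (k j) + δ (k j) - μ| ≤ cT * w ^ 2) ∧
          sectorIndex n (Complex.arg (⟨k 0 0, k 0 1⟩ : ℂ)) = (ω₁ : ℕ) ∧
          sectorIndex n (Complex.arg (⟨k 1 0, k 1 1⟩ : ℂ)) = i ∧
          sectorIndex n (Complex.arg (⟨k 2 0, k 2 1⟩ : ℂ)) = c ∧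
          sectorIndex n (Complex.arg (⟨k 3 0, k 3 1⟩ : ℂ)) = d ∧
          (∀ i, ∑ j, k j i = 2 * Real.pi * (G i : ℝ)))
      (R := fun i c => ∃ θ₁' x' y' : ℝ, |θ₁ - θ₁'| ≤ w ∧ |w / 2 + i * w - x'| ≤ w ∧ |w / 2 + c * w - y'| ≤ w ∧
          |hfunE δ u μ (XE u θ₁', YE u θ₁') x' y'| ≤ Cr * w ^ 2) hC₀pos.le ?hfib ?himp
    case hfib =>
      intro i c hi hc'
      have hr : 0 ≤ 4 * (2 * B.Dcell) * w := by positivity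
      have humin : ∀ θ, B.umin ≤ u θ := fun θ => umin_le_of_shifted B hδsq hlo' hhi' (hu θ)
      set x := 2 * π * (G 0 : ℝ) - u θ₁ * Real.cos θ₁ - u (w / 2 + i * w) * Real.cos (w / 2 + i * w) - u (w / 2 + c * w) * Real.cos (w / 2 + c * w) with hx
      set y := 2 * π * (G 1 : ℝ) - u θ₁ * Real.sin θ₁ - u (w / 2 + i * w) * Real.sin (w / 2 + i * w) - u (w / 2 + c * w) * Real.sin (w / 2 + c * w) with hy
      have hbox := card_grid_in_box_le_radial (R := u) hum humin hwpos hNw hr (N := sectorCount n) (x := x) (y := y)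
      refine le_trans ?_ (hbox.trans (le_of_eq (by rw [hC₀]; field_simp)))
      refine Nat.cast_le.2 (Finset.card_le_card (Finset.monotone_filter_right _ fun d _ hQ => ?_))
      obtain ⟨k, hk, hsh, hi0, hi1, hi2, hi3, hsum⟩ := hQ
      have c0 := hcell (k 0) _ (hk 0) (hsh 0) hi0; have c1 := hcell (k 1) _ (hk 1) (hsh 1) hi1
      have c2 := hcell (k 2) _ (hk 2) (hsh 2) hi2; have c3 := hcell (k 3) _ (hk 3) (hsh 3) hi3
      have c00 := c0 0; have c01 := c0 1; have c10 := c1 0; have c11 := c1 1; have c20 := c2 0; have c21 := c2 1; have c30 := c3 0; have c31 := c3 1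
      simp only [Pi.smul_apply, smul_eq_mul, dir_zero, dir_one] at c00 c01 c10 c11 c20 c21 c30 c31
      have hs0 := hsum 0; have hs1 := hsum 1
      rw [Fin.sum_univ_four] at hs0 hs1
      constructor
      · have e : u (w / 2 + d * w) * Real.cos (w / 2 + d * w) - x =
            (u (w / 2 + d * w) * Real.cos (w / 2 + d * w) - k 3 0) - (k 0 0 - u θ₁ * Real.cos θ₁) -
            (k 1 0 - u (w / 2 + i * w) * Real.cos (w / 2 + i * w)) - (k 2 0 - u (w / 2 + c * w) * Real.cos (w / 2 + c * w)) +
            (k 0 0 + k 1 0 + k 2 0 + k 3 0 - 2 * π * (G 0 : ℝ)) := by rw [hx]; ring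
        rw [e, hs0, sub_self, add_zero]
        have t1 := abs_sub (u (w / 2 + d * w) * Real.cos (w / 2 + d * w) - k 3 0 - (k 0 0 - u θ₁ * Real.cos θ₁) -
            (k 1 0 - u (w / 2 + i * w) * Real.cos (w / 2 + i * w))) (k 2 0 - u (w / 2 + c * w) * Real.cos (w / 2 + c * w))
        have t2 := abs_sub (u (w / 2 + d * w) * Real.cos (w / 2 + d * w) - k 3 0 - (k 0 0 - u θ₁ * Real.cos θ₁))
            (k 1 0 - u (w / 2 + i * w) * Real.cos (w / 2 + i * w))
        have t3 := abs_sub (u (w / 2 + d * w) * Real.cos (w / 2 + d * w) - k 3 0) (k 0 0 - u θ₁ * Real.cos θ₁)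
        have t4 : |u (w / 2 + d * w) * Real.cos (w / 2 + d * w) - k 3 0| ≤ 2 * B.Dcell * w := by rw [abs_sub_comm]; exact c30
        rw [hθ₁] at t1 t2 t3 ⊢
        linarith [t1, t2, t3, t4, c00, c10, c20]
      · have e : u (w / 2 + d * w) * Real.sin (w / 2 + d * w) - y =
            (u (w / 2 + d * w) * Real.sin (w / 2 + d * w) - k 3 1) - (k 0 1 - u θ₁ * Real.sin θ₁) -
            (k 1 1 - u (w / 2 + i * w) * Real.sin (w / 2 + i * w)) - (k 2 1 - u (w / 2 + c * w) * Real.sin (w / 2 + c * w)) +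
            (k 0 1 + k 1 1 + k 2 1 + k 3 1 - 2 * π * (G 1 : ℝ)) := by rw [hy]; ring
        rw [e, hs1, sub_self, add_zero]
        have t1 := abs_sub (u (w / 2 + d * w) * Real.sin (w / 2 + d * w) - k 3 1 - (k 0 1 - u θ₁ * Real.sin θ₁) -
            (k 1 1 - u (w / 2 + i * w) * Real.sin (w / 2 + i * w))) (k 2 1 - u (w / 2 + c * w) * Real.sin (w / 2 + c * w))
        have t2 := abs_sub (u (w / 2 + d * w) * Real.sin (w / 2 + d * w) - k 3 1 - (k 0 1 - u θ₁ * Real.sin θ₁))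
            (k 1 1 - u (w / 2 + i * w) * Real.sin (w / 2 + i * w))
        have t3 := abs_sub (u (w / 2 + d * w) * Real.sin (w / 2 + d * w) - k 3 1) (k 0 1 - u θ₁ * Real.sin θ₁)
        have t4 : |u (w / 2 + d * w) * Real.sin (w / 2 + d * w) - k 3 1| ≤ 2 * B.Dcell * w := by rw [abs_sub_comm]; exact c31
        rw [hθ₁] at t1 t2 t3 ⊢
        linarith [t1, t2, t3, t4, c01, c11, c21]
    case himp =>
      intro i c d hi hc' hd hQ
      obtain ⟨k, hk, hsh, hi0, hi1, hi2, hi3, hsum⟩ := hQ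
      obtain ⟨φ₀, hφ₀, p0⟩ := hproj (k 0) _ (hk 0) (hsh 0) hi0
      obtain ⟨φ₁, hφ₁, p1⟩ := hproj (k 1) _ (hk 1) (hsh 1) hi1
      obtain ⟨φ₂, hφ₂, p2⟩ := hproj (k 2) _ (hk 2) (hsh 2) hi2
      obtain ⟨φ₃, -, p3⟩ := hproj (k 3) _ (hk 3) (hsh 3) hi3
      refine ⟨φ₀, φ₁, φ₂, hφ₀, hφ₁, hφ₂, ?_⟩
      have p00 := p0 0; have p01 := p0 1; have p10 := p1 0; have p11 := p1 1; have p20 := p2 0; have p21 := p2 1; have p30 := p3 0; have p31 := p3 1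
      simp only [Pi.smul_apply, smul_eq_mul, dir_zero, dir_one] at p00 p01 p10 p11 p20 p21 p30 p31
      have hs0 := hsum 0; have hs1 := hsum 1
      rw [Fin.sum_univ_four] at hs0 hs1
      set ρ := cT * w ^ 2 / (B.Dtmin - κ) with hρ
      have hx : |(XE u φ₀, YE u φ₀).1 + u φ₁ * Real.cos φ₁ + u φ₂ * Real.cos φ₂ + u φ₃ * Real.cos φ₃ - 2 * π * (G 0 : ℝ)| ≤ 4 * ρ := by
        have e : (XE u φ₀, YE u φ₀).1 + u φ₁ * Real.cos φ₁ + u φ₂ * Real.cos φ₂ + u φ₃ * Real.cos φ₃ - 2 * π * (G 0 : ℝ) =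
            -(k 0 0 - u φ₀ * Real.cos φ₀) - (k 1 0 - u φ₁ * Real.cos φ₁) - (k 2 0 - u φ₂ * Real.cos φ₂) - (k 3 0 - u φ₃ * Real.cos φ₃) +
            (k 0 0 + k 1 0 + k 2 0 + k 3 0 - 2 * π * (G 0 : ℝ)) := by simp only [XE]; ring
        rw [e, hs0, sub_self, add_zero]
        have t1 := abs_sub (-(k 0 0 - u φ₀ * Real.cos φ₀) - (k 1 0 - u φ₁ * Real.cos φ₁) - (k 2 0 - u φ₂ * Real.cos φ₂)) (k 3 0 - u φ₃ * Real.cos φ₃)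
        have t2 := abs_sub (-(k 0 0 - u φ₀ * Real.cos φ₀) - (k 1 0 - u φ₁ * Real.cos φ₁)) (k 2 0 - u φ₂ * Real.cos φ₂)
        have t3 := abs_sub (-(k 0 0 - u φ₀ * Real.cos φ₀)) (k 1 0 - u φ₁ * Real.cos φ₁)
        rw [abs_neg] at t3
        linarith [t1, t2, t3, p00, p10, p20, p30]
      have hy : |(XE u φ₀, YE u φ₀).2 + u φ₁ * Real.sin φ₁ + u φ₂ * Real.sin φ₂ + u φ₃ * Real.sin φ₃ - 2 * π * (G 1 : ℝ)| ≤ 4 * ρ := by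
        have e : (XE u φ₀, YE u φ₀).2 + u φ₁ * Real.sin φ₁ + u φ₂ * Real.sin φ₂ + u φ₃ * Real.sin φ₃ - 2 * π * (G 1 : ℝ) =
            -(k 0 1 - u φ₀ * Real.sin φ₀) - (k 1 1 - u φ₁ * Real.sin φ₁) - (k 2 1 - u φ₂ * Real.sin φ₂) - (k 3 1 - u φ₃ * Real.sin φ₃) +
            (k 0 1 + k 1 1 + k 2 1 + k 3 1 - 2 * π * (G 1 : ℝ)) := by simp only [YE]; ring
        rw [e, hs1, sub_self, add_zero]
        have t1 := abs_sub (-(k 0 1 - u φ₀ * Real.sin φ₀) - (k 1 1 - u φ₁ * Real.sin φ₁) - (k 2 1 - u φ₂ * Real.sin φ₂)) (k 3 1 - u φ₃ * Real.sin φ₃)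
        have t2 := abs_sub (-(k 0 1 - u φ₀ * Real.sin φ₀) - (k 1 1 - u φ₁ * Real.sin φ₁)) (k 2 1 - u φ₂ * Real.sin φ₂)
        have t3 := abs_sub (-(k 0 1 - u φ₀ * Real.sin φ₀)) (k 1 1 - u φ₁ * Real.sin φ₁)
        rw [abs_neg] at t3
        linarith [t1, t2, t3, p01, p11, p21, p31]
      have h := abs_hfunE_le_of_sum hδs heven hper hκ' hu hx hy
      exact h.trans (by rw [hρ]; exact hρCr)
    -- Step 2: the thin pair count, uniform in everything
    have hP := hcount δ hδs heven (fun k => (hδ k).trans hκp') (fun k => (hκ' k).trans hκp') (fun k => (hκ₂ k).trans hκp') μ hloG hhiG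
      u hu θ₁ w (sectorCount n) (2 ^ n) hwpos hww₁ hNw (by push_cast; exact h2n) hNeq
    clear hcount
    -- Step 3: arithmetic
    have hwinv : 1 / w = 2 ^ n / π := by rw [← h2n]; field_simp
    refine hmain.trans ?_
    have e3 : Kp / w = Kp / π * 2 ^ n := by rw [div_eq_mul_one_div Kp w, hwinv]; ring
    calc C₀ * _ ≤ C₀ * (Kp / w) := mul_le_mul_of_nonneg_left hP hC₀pos.le
      _ = K₂ * 2 ^ n := by rw [e3, hK₂]; ring
      _ ≤ (K₁ + K₂) * 2 ^ n := by nlinarith only [hK₁pos, h2npos]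
  · -- small `n`: `2ⁿ < π / w₀`
    clear hcount
    push Not at hwle
    have h2nlt : (2 : ℝ) ^ n ≤ π / w₀ := by
      rw [le_div_iff₀ hw₀pos, ← h2n]
      exact mul_le_mul_of_nonneg_left hwle.le h2npos.le
    have hbound : (sectorCount n : ℝ) ^ 3 ≤ K₁ * 2 ^ n := by
      rw [hNreal, hK₁]
      have hsq : ((2 : ℝ) ^ n) ^ 2 ≤ (π / w₀) ^ 2 := pow_le_pow_left₀ h2npos.le h2nlt 2
      have e : (2 * (2 : ℝ) ^ n) ^ 3 = 8 * ((2 : ℝ) ^ n) ^ 2 * 2 ^ n := by ring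
      rw [e]
      exact mul_le_mul_of_nonneg_right (mul_le_mul_of_nonneg_left hsq (by norm_num)) h2npos.le
    refine (htriv _).trans (hbound.trans ?_)
    nlinarith only [hK₂pos, h2npos]

end Summit.HubbardSuperconductivity.HubbardSuperconductivity.Theorems.PerturbedFermiCurve

end
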